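import Summits.ValiantsHypothesis.ValiantsHypothesis.Theorems.DivisionGapPerDivisionHardCellContent

/-!
# Crux `DivisionGap.PerDivisionHard` (stmt-ValiantsHypothesis-5065), line `pair-descent-jss-endpoint`
(v14.2) — corollary `perDivisionHard_lowPartialDegree` of the cell-content rung

The cell-content rung `perDivisionHard_cellContent`
(`Theorems/DivisionGapPerDivisionHardCellContent.lean`) gives the crux inequality
`2^{(log₂ n + c)^c} < L(per_n · h) + L(h)` for every nonzero cofactor `h ∈ ℝ≥0[x_ij]` whose monomials
have at most `2^{(log₂ n + c)^c}` distinct `Y`-contents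
`Φ_Y(m) = ((Σ_{cc : (r,cc) ∈ Y} m(r,cc))_r, (Σ_{r : (r,cc) ∈ Y} m(r,cc))_cc)` for some balanced cell set
`Y` (`n² ≤ 4|Y| ≤ 3n²`).  This file records the degree form of that rung:

* `perDivisionHard_lowPartialDegree` — if every monomial of `h` has total degree at most `d` in the
  variables of `Y` (`Σ_{e ∈ Y} m(e) ≤ d`) and `(n² + 1)^{2d} ≤ 2^{(log₂ n + c)^c}`, then
  `2^{(log₂ n + c)^c} < L(per_n · h) + L(h)`.

So a cofactor of polylogarithmically small PARTIAL degree in the variables of a balanced half of the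
matrix — arbitrary in the other half — never helps.  The count: `Φ_Y(m)` only reads the restriction
`m|_Y` of the exponent vector to `Y`, a vector of weight `Σ_{e ∈ Y} m(e) ≤ d`, i.e. a multiset of at
most `d` cells; listing such a multiset and padding to length `d` embeds these restrictions into
`(cells ⊕ {∗})^d`, so there are at most `(n² + 1)^d ≤ (n² + 1)^{2d}` of them
(`card_le_pow_of_sum_le`). [folklore]
-/

noncomputable section

-- `Summit.ValiantsHypothesis.ValiantsHypothesis.…` is the tree's mandated single-conjunct layout
-- (Sub = Summit), so the duplicated namespace component is intended.
set_option linter.dupNamespace false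

namespace Summit.ValiantsHypothesis.ValiantsHypothesis.Theorems.DivisionGapPerDivisionHard

open MvPolynomial Literature.Computability.AlgebraicComplexity
open scoped NNReal

/-- **Counting vectors of bounded weight.**  A finite set of vectors `w : α →₀ ℕ` over a finite type
`α`, each of weight `Σ_a w(a) ≤ d`, has at most `(|α| + 1)^d` elements: the sorted list of the
multiset `Finsupp.toMultiset w` (of length `≤ d`), read through `List.getElem?` at the indices `< d`,
is an injective encoding into `Fin d → Option α`. [folklore] -/
theorem card_le_pow_of_sum_le {α : Type*} [Fintype α] [DecidableEq α] (d : ℕ)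
    (s : Finset (α →₀ ℕ)) (hs : ∀ w ∈ s, ∑ a, w a ≤ d) :
    s.card ≤ (Fintype.card α + 1) ^ d := by
  classical
  have hlen : ∀ w ∈ s, (Finsupp.toMultiset w).toList.length ≤ d := fun w hw => by
    rw [Multiset.length_toList, Finsupp.card_toMultiset, Finsupp.sum_fintype _ _ (fun _ => rfl)]
    exact hs w hw
  have hinj : Set.InjOn (fun (w : α →₀ ℕ) (i : Fin d) => (Finsupp.toMultiset w).toList[(i : ℕ)]?)
      (s : Set (α →₀ ℕ)) := by
    intro w₁ h₁ w₂ h₂ heq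
    have hlist : (Finsupp.toMultiset w₁).toList = (Finsupp.toMultiset w₂).toList := by
      apply List.ext_getElem?
      intro i
      by_cases hi : i < d
      · exact congrFun heq ⟨i, hi⟩
      · rw [List.getElem?_eq_none (le_trans (hlen w₁ h₁) (not_lt.mp hi)),
          List.getElem?_eq_none (le_trans (hlen w₂ h₂) (not_lt.mp hi))]
    have hmul : Finsupp.toMultiset w₁ = Finsupp.toMultiset w₂ := by
      rw [← Multiset.coe_toList (Finsupp.toMultiset w₁), hlist, Multiset.coe_toList]
    rw [← Finsupp.toMultiset_toFinsupp w₁, hmul, Finsupp.toMultiset_toFinsupp]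
  calc s.card
      = (s.image fun (w : α →₀ ℕ) (i : Fin d) => (Finsupp.toMultiset w).toList[(i : ℕ)]?).card :=
        (Finset.card_image_of_injOn hinj).symm
    _ ≤ Fintype.card (Fin d → Option α) := Finset.card_le_univ _
    _ = (Fintype.card α + 1) ^ d := by
        rw [Fintype.card_fun, Fintype.card_option, Fintype.card_fin]

/-- **The low-partial-degree corollary of the cell-content rung of `PerDivisionHard`.**  For every `c`
there is `n₀` such that for all `n ≥ n₀`, every nonzero `h ∈ ℝ≥0[x_ij]`, every set `Y` of cells with
`n² ≤ 4|Y| ≤ 3n²` and every `d`: if every monomial of `h` has degree at most `d` in the variables of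
`Y` (`Σ_{e ∈ Y} m(e) ≤ d`) and `(n² + 1)^{2d} ≤ 2^{(log₂ n + c)^c}`, then
`2^{(log₂ n + c)^c} < L(per_n · h) + L(h)`.  Reduction to `perDivisionHard_cellContent`: the
`Y`-content `Φ_Y(m)` factors through the restriction `m|_Y = m.filter (· ∈ Y)`, a vector of weight
`Σ_{e ∈ Y} m(e) ≤ d`, and there are at most `(n² + 1)^d` such vectors (`card_le_pow_of_sum_le`).
[folklore] -/
theorem perDivisionHard_lowPartialDegree :
    ∀ c : ℕ, ∃ n₀ : ℕ, ∀ n ≥ n₀, ∀ h : MvPolynomial (Fin n × Fin n) ℝ≥0, h ≠ 0 →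
      ∀ (Y : Finset (Fin n × Fin n)) (d : ℕ), n * n ≤ 4 * Y.card → 4 * Y.card ≤ 3 * (n * n) →
      (∀ mm ∈ h.support, ∑ e ∈ Y, mm e ≤ d) → (n * n + 1) ^ (2 * d) ≤ 2 ^ ((Nat.log 2 n + c) ^ c) →
      2 ^ ((Nat.log 2 n + c) ^ c) < complexity (perPoly (Fin n) ℝ≥0 * h) + complexity h := by
  intro c
  obtain ⟨n₀, hcell⟩ := perDivisionHard_cellContent c
  refine ⟨n₀, fun n hn h hh Y d hY₁ hY₂ hdeg hpow => ?_⟩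
  classical
  refine hcell n hn h hh Y hY₁ hY₂ (le_trans ?_ hpow)
  -- the `Y`-content only reads the restriction of the exponent vector to `Y`
  have hfac : (fun (mm : (Fin n × Fin n) →₀ ℕ) =>
        ((fun r : Fin n => ∑ cc ∈ Finset.univ.filter (fun cc : Fin n => (r, cc) ∈ Y), mm (r, cc)),
         (fun cc : Fin n => ∑ r ∈ Finset.univ.filter (fun r : Fin n => (r, cc) ∈ Y), mm (r, cc)))) =
      (fun (mm : (Fin n × Fin n) →₀ ℕ) =>
        ((fun r : Fin n => ∑ cc ∈ Finset.univ.filter (fun cc : Fin n => (r, cc) ∈ Y), mm (r, cc)),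
         (fun cc : Fin n => ∑ r ∈ Finset.univ.filter (fun r : Fin n => (r, cc) ∈ Y), mm (r, cc)))) ∘
      (fun (mm : (Fin n × Fin n) →₀ ℕ) => mm.filter (fun e : Fin n × Fin n => e ∈ Y)) := by
    funext mm
    simp only [Function.comp_apply]
    congr 1
    · funext r
      refine Finset.sum_congr rfl fun cc hcc => ?_
      exact (Finsupp.filter_apply_pos _ mm (Finset.mem_filter.mp hcc).2).symm
    · funext cc
      refine Finset.sum_congr rfl fun r hr => ?_
      exact (Finsupp.filter_apply_pos _ mm (Finset.mem_filter.mp hr).2).symm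
  rw [hfac, ← Finset.image_image]
  refine le_trans Finset.card_image_le ?_
  -- the restrictions have weight `≤ d`
  have hbound : (h.support.image fun (mm : (Fin n × Fin n) →₀ ℕ) =>
      mm.filter (fun e : Fin n × Fin n => e ∈ Y)).card ≤ (Fintype.card (Fin n × Fin n) + 1) ^ d := by
    refine card_le_pow_of_sum_le d _ fun w hw => ?_
    rw [Finset.mem_image] at hw
    obtain ⟨mm, hmm, rfl⟩ := hw
    refine le_trans (le_of_eq ?_) (hdeg mm hmm)
    simp only [Finsupp.filter_apply]
    exact Finset.sum_ite_mem_eq Y mm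
  calc (h.support.image fun (mm : (Fin n × Fin n) →₀ ℕ) =>
          mm.filter (fun e : Fin n × Fin n => e ∈ Y)).card
      ≤ (Fintype.card (Fin n × Fin n) + 1) ^ d := hbound
    _ = (n * n + 1) ^ d := by rw [Fintype.card_prod, Fintype.card_fin]
    _ ≤ (n * n + 1) ^ (2 * d) := Nat.pow_le_pow_right (Nat.succ_pos _) (by omega)

end Summit.ValiantsHypothesis.ValiantsHypothesis.Theorems.DivisionGapPerDivisionHard

end
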